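import Summits.Ventures.QEC.Census.TwoBGA.S8_2x20_w8_k16_000106.Distance
import Summits.Ventures.QEC.Census.BB.A1s_n54_k4_67d5b507.Distance
import Summits.Ventures.QEC.Census.BB.A1s_n56_k6_dc07204f.Distance
import Summits.Ventures.QEC.Census.BB.BBRows
import Summits.Ventures.QEC.Census.BB.Claims
import Literature.InformationTheory.QuantumCodes.TwoBlockConnectedComponents
import Literature.InformationTheory.QuantumCodes.TwoBlockToricLayout
import Literature.InformationTheory.QuantumCodes.TwoBlockWheelComponents
import Literature.InformationTheory.QuantumCodes.TwoBlockRootParameters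
import HarnessLib
import HarnessLib.Audit.Tags

/-!
# Census rows as TYPED two-block codes `QC(A, B)` on `ℤ_ℓ × ℤ_m` — bridge batch `DirRowsQC02` (3 row(s), kernel tier)

Family: abelian two-block over ℤ_ℓ × ℤ_m (qec census one-module KERNEL-std rows: qec-search-7 certificate modules, MITM and
Brouwer–Zimmermann/automorphism formats). For each census row below (an EXPLICIT matrix code
`cert.code _ = CSSCode.ofMatrices (rowMatrix n cert.HX) (rowMatrix n cert.HZ)` with `IsCode n k d` certified in its own module), this file
puts the row's CONSTRUCTION into the kernel statement, as in the pilot `Census/BB/A1s_n144_k32_4addf704QC.lean` (p511732) and the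
gen-4 batches `A1sRowsQC1–5` / `TwoBGARowsQC1–4`: monomial lists `la`, `lb` (from the certificate's construction record — the
docstring's `A_terms`/`B_terms` or the census row id `2bga-lℓmm-A…-B…`, monomials `xⁱyʲ` as `[i,j]`, convention of BCGMRY24 §4 =
`BivariateBicycleCodes.lean`; the index identity was ALSO re-verified row-for-row by the emitter before filing), the typed object
`qc : BB.Code ℓ m := ⟨polyL la, polyL lb⟩`, the kernel INDEX IDENTITIES `cert.HX = BBRows.rowsX la lb`, `cert.HZ = BBRows.rowsZ la lb`
(`decide`; verified row generator `Census/BB/BBRows.lean`, p502918), the flat identities via `BBRows.rowMatrix_rowsX/Z`, the transport of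
the row's own `dZ_eq` and `k` (its `k_eq`, or the `k`-component of its `isCode`) by type-05's `BB.Code.dZ_eq_of_flat` / `k_eq_of_flat` to
`qc_hasParams : BB.HasParams qc n k d` (census predicate of family BB, `Census/BB/Claims.lean`, distance EXACT) and
`qc_isCode : qc.css.IsCode n k d`; and the census LAYOUT columns (Bravyi et al. 2024 §4 — arXiv:2308.07915: Lemma 2 p0010 L49, Lemma 3 p0011 L9, Lemma 4 p0011 L28; locators per qec-ref-2 2026-08-27T10:27Z) as KERNEL verdicts: «connected» —
`qc_tannerGraph_connected` (Lemma 3, `BB.Code.tannerGraph_connected_of_unit_mem`, explicit multiples of exponent differences) or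
`qc_tannerGraph_not_connected` + `card_expDiffSubgroup` + `qc_card_connectedComponent` (`⟨S⟩` = an explicit finite carrier `diffList`,
both inclusions certified; exact component count by Lemma 3 (ii), `BB.Code.card_connectedComponent_mul_card`; by the tree's connected
normal form `TwoBlockConnectedComponents.lean` such a code is the disjoint union of that many copies of its root code, whose parameters
`[[n/c, k/c, d]]` and connectedness are certified here as `root_isCode` via `TwoBlockRootParameters.lean`); «toric layout» —
`qc_hasToricLayoutWith μ λ` (Lemma 4, `BB.Code.hasToricLayoutWith_of_exponents`; omitted when its sufficient condition has no witness);
«wheel layers» — `qc_wheel_layers` (Lemma 2 minus planarity, `BB.Code.exists_wheel_layers`, weight-(3,3) rows only):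

* `S8_2x20_w8_k16_000106` = `QC(1 + y + y^6 + xy^15, 1 + y^2 + y^5 + xy^7)` on `ℤ_2 × ℤ_20`: `[[80, 16, 8]]`; Tanner graph connected; toric layout (4,10)
* `A1s_n54_k4_67d5b507` = `QC(1 + y + x, y^5 + y^6 + x^2)` on `ℤ_3 × ℤ_9`: `[[54, 4, 8]]`; Tanner graph connected; toric layout (9,3); wheel layers 18/18
* `A1s_n56_k6_dc07204f` = `QC(y + y^5 + x^3, y^4 + y^6 + x^2)` on `ℤ_4 × ℤ_7`: `[[56, 6, 8]]`; Tanner graph connected; wheel layers 56/14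

No new certificate — tier KERNEL, axioms standard, no `native_decide`. HONEST FRAMING: identifies already-certified census objects with
named algebraic constructions and decides structural (graph) properties; the census comparator columns (printed values, optimality
words) are not touched; for disconnected rows the root code is identified abstractly over `↥⟨S⟩` (not re-indexed to a named `QC(A',B')`,
not identified with a smaller census row); planarity/thickness is not asserted. Generated by
qec-type-05 gen 5's `tools/emit_qc_bridge2.py` + `tools/conn_cert.py` (HOME/lean/type-05/tools/).
-/

namespace Summit.Ventures.QEC.Census.S8_2x20_w8_k16_000106

open Matrix Literature.InformationTheory.QuantumCodes BBRows

/-- Monomials of `A = 1 + y + y^6 + xy^15` (construction `A_terms = [[0, 0], [0, 1], [0, 6], [1, 15]]`, from the census row id `2bga-l2m20-A0-0.0-1.0-6.1-15-B0-0.0-2.0-5.1-7` named in the row module). DATA. -/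
def la : List (BB.Mono 2 20) := [(Fin.ofNat 2 0, Fin.ofNat 20 0), (Fin.ofNat 2 0, Fin.ofNat 20 1), (Fin.ofNat 2 0, Fin.ofNat 20 6), (Fin.ofNat 2 1, Fin.ofNat 20 15)]

/-- Monomials of `B = 1 + y^2 + y^5 + xy^7` (construction `B_terms = [[0, 0], [0, 2], [0, 5], [1, 7]]`). DATA. -/
def lb : List (BB.Mono 2 20) := [(Fin.ofNat 2 0, Fin.ofNat 20 0), (Fin.ofNat 2 0, Fin.ofNat 20 2), (Fin.ofNat 2 0, Fin.ofNat 20 5), (Fin.ofNat 2 1, Fin.ofNat 20 7)]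

/-- The census row's code as a TYPED two-block code `QC(1 + y + y^6 + xy^15, 1 + y^2 + y^5 + xy^7)` on `ℤ_2 × ℤ_20` (`BB.Code 2 20`). (definition) -/
def qc : BB.Code 2 20 := ⟨polyL la, polyL lb⟩

set_option maxRecDepth 100000 in
/-- INDEX IDENTITY, `X` side, in the kernel: the certificate's `H^X` rows ARE the `X`-check words of `qc` (`decide +kernel`). -/
theorem HX_eq_rowsX : S8_2x20_w8_k16_000106.cert.HX = rowsX la lb := by
  decide +kernel

set_option maxRecDepth 100000 in
/-- INDEX IDENTITY, `Z` side. -/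
theorem HZ_eq_rowsZ : S8_2x20_w8_k16_000106.cert.HZ = rowsZ la lb := by
  decide +kernel

set_option maxRecDepth 100000 in
/-- The certificate's flat `H^X` is `qc.HXFlat`. -/
theorem rowMatrix_HX_eq : rowMatrix 80 S8_2x20_w8_k16_000106.cert.HX = qc.HXFlat := by
  have cast : ∀ {H H' : List ℕ} (e : H = H'),
      rowMatrix 80 H = (rowMatrix 80 H').submatrix (Fin.cast (congrArg List.length e)) id := by
    intro H H' e; subst e; rfl
  exact (cast HX_eq_rowsX).trans (rowMatrix_rowsX qc (LA := la) (LB := lb) rfl rfl)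

set_option maxRecDepth 100000 in
/-- The certificate's flat `H^Z` is `qc.HZFlat`. -/
theorem rowMatrix_HZ_eq : rowMatrix 80 S8_2x20_w8_k16_000106.cert.HZ = qc.HZFlat := by
  have cast : ∀ {H H' : List ℕ} (e : H = H'),
      rowMatrix 80 H = (rowMatrix 80 H').submatrix (Fin.cast (congrArg List.length e)) id := by
    intro H H' e; subst e; rfl
  exact (cast HZ_eq_rowsZ).trans (rowMatrix_rowsZ qc (LA := la) (LB := lb) rfl rfl)

set_option maxRecDepth 100000 in
/-- `d^Z (qc) = 8`, transported from the census certificate (`S8_2x20_w8_k16_000106.dZ_eq`) by `BB.Code.dZ_eq_of_flat`. -/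
theorem qc_dZ : qc.css.dZ = 8 :=
  (qc.dZ_eq_of_flat (D := S8_2x20_w8_k16_000106.cert.code (S8_2x20_w8_k16_000106.cert.commOK_of_checkStructure S8_2x20_w8_k16_000106.checkStructure_ok))
    rowMatrix_HX_eq rowMatrix_HZ_eq).symm.trans S8_2x20_w8_k16_000106.dZ_eq

set_option maxRecDepth 100000 in
/-- `k (qc) = 16`, transported from the census certificate (`S8_2x20_w8_k16_000106.k_eq`) by `BB.Code.k_eq_of_flat`. -/
theorem qc_k : qc.k = 16 :=
  (qc.k_eq_of_flat (D := S8_2x20_w8_k16_000106.cert.code (S8_2x20_w8_k16_000106.cert.commOK_of_checkStructure S8_2x20_w8_k16_000106.checkStructure_ok))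
    rowMatrix_HX_eq rowMatrix_HZ_eq).symm.trans S8_2x20_w8_k16_000106.k_eq

/-- **`QC(1 + y + y^6 + xy^15, 1 + y^2 + y^5 + xy^7)` on `ℤ_2 × ℤ_20` has parameters `[[80, 16, 8]]`** (distance exact; `BB.HasParams`) — the census row
`S8_2x20_w8_k16_000106` read as a statement about the construction. KERNEL. -/
theorem qc_hasParams : Summit.Ventures.QEC.BB.HasParams qc 80 16 8 :=
  BB.hasParams_of_dZ (by simp only [BB.numQubits_eq]) qc_k qc_dZ

/-- The same in the generic census vocabulary: `qc.css.IsCode 80 16 8`. -/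
theorem qc_isCode : qc.css.IsCode 80 16 8 :=
  (BB.hasParams_iff_isCode (by decide)).1 qc_hasParams

set_option maxRecDepth 100000 in
/-- **The Tanner graph of `qc` is connected** (Bravyi et al. 2024 Lemma 3 / `BB.Code.tannerGraph_connected_of_unit_mem`): `x = (1,0)`
and `y = (0,1)` are explicit combinations of exponent differences inside `A` or inside `B` (found by qec-type-05's tools/conn_cert.py,
re-checked by `decide`). Census column «connected» for this row, KERNEL. -/
theorem qc_tannerGraph_connected : qc.css.tannerGraph.Connected := by
  refine qc.tannerGraph_connected_of_unit_mem (fun h => absurd (congrFun h ((0 : Fin 2), (0 : Fin 20))) (by decide))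
    (fun h => absurd (congrFun h ((0 : Fin 2), (0 : Fin 20))) (by decide)) ?_ ?_
  · have e : (((1 : Fin 2), (0 : Fin 20)) : BB.Mono 2 20) = (5 : ℕ) • ((((0 : Fin 2), (0 : Fin 20))) - (0, 1)) + (1 : ℕ) • ((((0 : Fin 2), (0 : Fin 20))) - (1, 15)) := by decide
    rw [e]
    exact (AddSubgroup.add_mem _ (AddSubgroup.nsmul_mem _ (qc.sub_mem_expDiffSubgroup_A (by decide) (by decide)) 5) (AddSubgroup.nsmul_mem _ (qc.sub_mem_expDiffSubgroup_A (by decide) (by decide)) 1))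
  · have e : (((0 : Fin 2), (1 : Fin 20)) : BB.Mono 2 20) = (19 : ℕ) • ((((0 : Fin 2), (0 : Fin 20))) - (0, 1)) := by decide
    rw [e]
    exact (AddSubgroup.nsmul_mem _ (qc.sub_mem_expDiffSubgroup_A (by decide) (by decide)) 19)

/-- The two layout generators `A_iA_jᵀ ↦ (0, 0) − (1, 15)` and `B_gB_hᵀ ↦ (0, 5) − (1, 7)` generate `ℤ_2 × ℤ_20`
(explicit multiples giving `x` and `y`, `decide`d). -/
theorem qc_layout_closure_eq_top : AddSubgroup.closure ({((0 : Fin 2), (0 : Fin 20)) - (1, 15), ((0 : Fin 2), (5 : Fin 20)) - (1, 7)} : Set (BB.Mono 2 20)) = ⊤ := by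
  apply BB.Code.addSubgroup_eq_top_of_unit_mem
  · have h1 := AddSubgroup.subset_closure (k := ({((0 : Fin 2), (0 : Fin 20)) - (1, 15), ((0 : Fin 2), (5 : Fin 20)) - (1, 7)} : Set (BB.Mono 2 20))) (Set.mem_insert _ _)
    have h2 := AddSubgroup.subset_closure (k := ({((0 : Fin 2), (0 : Fin 20)) - (1, 15), ((0 : Fin 2), (5 : Fin 20)) - (1, 7)} : Set (BB.Mono 2 20))) (Set.mem_insert_of_mem _ rfl)
    have e : (2 : ℕ) • (((0 : Fin 2), (0 : Fin 20)) - (1, 15)) + (5 : ℕ) • (((0 : Fin 2), (5 : Fin 20)) - (1, 7)) = (1, 0) := by decide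
    have h' := AddSubgroup.add_mem _ (AddSubgroup.nsmul_mem _ h1 2) (AddSubgroup.nsmul_mem _ h2 5)
    rw [e] at h'
    exact h'
  · have h1 := AddSubgroup.subset_closure (k := ({((0 : Fin 2), (0 : Fin 20)) - (1, 15), ((0 : Fin 2), (5 : Fin 20)) - (1, 7)} : Set (BB.Mono 2 20))) (Set.mem_insert _ _)
    have h2 := AddSubgroup.subset_closure (k := ({((0 : Fin 2), (0 : Fin 20)) - (1, 15), ((0 : Fin 2), (5 : Fin 20)) - (1, 7)} : Set (BB.Mono 2 20))) (Set.mem_insert_of_mem _ rfl)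
    have e : (3 : ℕ) • (((0 : Fin 2), (0 : Fin 20)) - (1, 15)) + (7 : ℕ) • (((0 : Fin 2), (5 : Fin 20)) - (1, 7)) = (0, 1) := by decide
    have h' := AddSubgroup.add_mem _ (AddSubgroup.nsmul_mem _ h1 3) (AddSubgroup.nsmul_mem _ h2 7)
    rw [e] at h'
    exact h'

set_option maxRecDepth 100000 in
/-- Orders of the two layout generators: `4` and `10` (product `40 = ℓm`). -/
theorem qc_layout_orders : addOrderOf (((0 : Fin 2), (0 : Fin 20)) - (1, 15)) = 4 ∧ addOrderOf (((0 : Fin 2), (5 : Fin 20)) - (1, 7)) = 10 :=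
  ⟨(addOrderOf_eq_iff (by norm_num)).mpr (by decide), (addOrderOf_eq_iff (by norm_num)).mpr (by decide)⟩

/-- **`qc` has a toric layout with `(μ, λ) = (4, 10)`** (Bravyi et al. 2024 Lemma 4 / `BB.Code.hasToricLayoutWith_of_exponents`):
census layout column, KERNEL. -/
theorem qc_hasToricLayoutWith : HasToricLayoutWith 4 10 qc.css.tannerGraph := by
  have h := qc.hasToricLayoutWith_of_exponents (g := ((0 : Fin 2), (0 : Fin 20))) (g' := (1, 15))
    (h := ((0 : Fin 2), (5 : Fin 20))) (h' := (1, 7)) (by decide) (by decide) (by decide) (by decide)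
    qc_layout_closure_eq_top (by rw [qc_layout_orders.1, qc_layout_orders.2])
  rwa [qc_layout_orders.1, qc_layout_orders.2] at h

/-- `qc` has a toric layout. KERNEL. -/
theorem qc_hasToricLayout : HasToricLayout qc.css.tannerGraph :=
  ⟨4, 10, by norm_num, by norm_num, qc_hasToricLayoutWith⟩

end Summit.Ventures.QEC.Census.S8_2x20_w8_k16_000106

namespace Summit.Ventures.QEC.Census.A1s_n54_k4_67d5b507

open Matrix Literature.InformationTheory.QuantumCodes BBRows

/-- Monomials of `A = 1 + y + x` (construction `A_terms = [[0, 0], [0, 1], [1, 0]]`, from the census generator file `census/search-3/gens/a1/A1s_n54_k4_67d5b507.json` (matrix_sha256 `67d5b5072500b6d5…`; `A = 1+y+x`, `B = y^5+y^6+x^2`)). DATA. -/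
def la : List (BB.Mono 3 9) := [(Fin.ofNat 3 0, Fin.ofNat 9 0), (Fin.ofNat 3 0, Fin.ofNat 9 1), (Fin.ofNat 3 1, Fin.ofNat 9 0)]

/-- Monomials of `B = y^5 + y^6 + x^2` (construction `B_terms = [[0, 5], [0, 6], [2, 0]]`). DATA. -/
def lb : List (BB.Mono 3 9) := [(Fin.ofNat 3 0, Fin.ofNat 9 5), (Fin.ofNat 3 0, Fin.ofNat 9 6), (Fin.ofNat 3 2, Fin.ofNat 9 0)]

/-- The census row's code as a TYPED two-block code `QC(1 + y + x, y^5 + y^6 + x^2)` on `ℤ_3 × ℤ_9` (`BB.Code 3 9`). (definition) -/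
def qc : BB.Code 3 9 := ⟨polyL la, polyL lb⟩

set_option maxRecDepth 100000 in
/-- INDEX IDENTITY, `X` side, in the kernel: the certificate's `H^X` rows ARE the `X`-check words of `qc` (`decide +kernel`). -/
theorem HX_eq_rowsX : A1s_n54_k4_67d5b507.cert.HX = rowsX la lb := by
  decide +kernel

set_option maxRecDepth 100000 in
/-- INDEX IDENTITY, `Z` side. -/
theorem HZ_eq_rowsZ : A1s_n54_k4_67d5b507.cert.HZ = rowsZ la lb := by
  decide +kernel

set_option maxRecDepth 100000 in
/-- The certificate's flat `H^X` is `qc.HXFlat`. -/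
theorem rowMatrix_HX_eq : rowMatrix 54 A1s_n54_k4_67d5b507.cert.HX = qc.HXFlat := by
  have cast : ∀ {H H' : List ℕ} (e : H = H'),
      rowMatrix 54 H = (rowMatrix 54 H').submatrix (Fin.cast (congrArg List.length e)) id := by
    intro H H' e; subst e; rfl
  exact (cast HX_eq_rowsX).trans (rowMatrix_rowsX qc (LA := la) (LB := lb) rfl rfl)

set_option maxRecDepth 100000 in
/-- The certificate's flat `H^Z` is `qc.HZFlat`. -/
theorem rowMatrix_HZ_eq : rowMatrix 54 A1s_n54_k4_67d5b507.cert.HZ = qc.HZFlat := by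
  have cast : ∀ {H H' : List ℕ} (e : H = H'),
      rowMatrix 54 H = (rowMatrix 54 H').submatrix (Fin.cast (congrArg List.length e)) id := by
    intro H H' e; subst e; rfl
  exact (cast HZ_eq_rowsZ).trans (rowMatrix_rowsZ qc (LA := la) (LB := lb) rfl rfl)

set_option maxRecDepth 100000 in
/-- `d^Z (qc) = 8`, transported from the census certificate (`A1s_n54_k4_67d5b507.dZ_eq`) by `BB.Code.dZ_eq_of_flat`. -/
theorem qc_dZ : qc.css.dZ = 8 :=
  (qc.dZ_eq_of_flat (D := A1s_n54_k4_67d5b507.cert.code A1s_n54_k4_67d5b507.commOK_cert)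
    rowMatrix_HX_eq rowMatrix_HZ_eq).symm.trans A1s_n54_k4_67d5b507.dZ_eq

set_option maxRecDepth 100000 in
/-- `k (qc) = 4`, transported from the census certificate (`A1s_n54_k4_67d5b507.k_eq`) by `BB.Code.k_eq_of_flat`. -/
theorem qc_k : qc.k = 4 :=
  (qc.k_eq_of_flat (D := A1s_n54_k4_67d5b507.cert.code A1s_n54_k4_67d5b507.commOK_cert)
    rowMatrix_HX_eq rowMatrix_HZ_eq).symm.trans A1s_n54_k4_67d5b507.k_eq

/-- **`QC(1 + y + x, y^5 + y^6 + x^2)` on `ℤ_3 × ℤ_9` has parameters `[[54, 4, 8]]`** (distance exact; `BB.HasParams`) — the census row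
`A1s_n54_k4_67d5b507` read as a statement about the construction. KERNEL. -/
theorem qc_hasParams : Summit.Ventures.QEC.BB.HasParams qc 54 4 8 :=
  BB.hasParams_of_dZ (by simp only [BB.numQubits_eq]) qc_k qc_dZ

/-- The same in the generic census vocabulary: `qc.css.IsCode 54 4 8`. -/
theorem qc_isCode : qc.css.IsCode 54 4 8 :=
  (BB.hasParams_iff_isCode (by decide)).1 qc_hasParams

set_option maxRecDepth 100000 in
/-- **The Tanner graph of `qc` is connected** (Bravyi et al. 2024 Lemma 3 / `BB.Code.tannerGraph_connected_of_unit_mem`): `x = (1,0)`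
and `y = (0,1)` are explicit combinations of exponent differences inside `A` or inside `B` (found by qec-type-05's tools/conn_cert.py,
re-checked by `decide`). Census column «connected» for this row, KERNEL. -/
theorem qc_tannerGraph_connected : qc.css.tannerGraph.Connected := by
  refine qc.tannerGraph_connected_of_unit_mem (fun h => absurd (congrFun h ((0 : Fin 3), (0 : Fin 9))) (by decide))
    (fun h => absurd (congrFun h ((0 : Fin 3), (5 : Fin 9))) (by decide)) ?_ ?_
  · have e : (((1 : Fin 3), (0 : Fin 9)) : BB.Mono 3 9) = (2 : ℕ) • ((((0 : Fin 3), (0 : Fin 9))) - (1, 0)) := by decide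
    rw [e]
    exact (AddSubgroup.nsmul_mem _ (qc.sub_mem_expDiffSubgroup_A (by decide) (by decide)) 2)
  · have e : (((0 : Fin 3), (1 : Fin 9)) : BB.Mono 3 9) = (8 : ℕ) • ((((0 : Fin 3), (0 : Fin 9))) - (0, 1)) := by decide
    rw [e]
    exact (AddSubgroup.nsmul_mem _ (qc.sub_mem_expDiffSubgroup_A (by decide) (by decide)) 8)

/-- The two layout generators `A_iA_jᵀ ↦ (0, 0) − (0, 1)` and `B_gB_hᵀ ↦ (0, 6) − (2, 0)` generate `ℤ_3 × ℤ_9`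
(explicit multiples giving `x` and `y`, `decide`d). -/
theorem qc_layout_closure_eq_top : AddSubgroup.closure ({((0 : Fin 3), (0 : Fin 9)) - (0, 1), ((0 : Fin 3), (6 : Fin 9)) - (2, 0)} : Set (BB.Mono 3 9)) = ⊤ := by
  apply BB.Code.addSubgroup_eq_top_of_unit_mem
  · have h1 := AddSubgroup.subset_closure (k := ({((0 : Fin 3), (0 : Fin 9)) - (0, 1), ((0 : Fin 3), (6 : Fin 9)) - (2, 0)} : Set (BB.Mono 3 9))) (Set.mem_insert _ _)
    have h2 := AddSubgroup.subset_closure (k := ({((0 : Fin 3), (0 : Fin 9)) - (0, 1), ((0 : Fin 3), (6 : Fin 9)) - (2, 0)} : Set (BB.Mono 3 9))) (Set.mem_insert_of_mem _ rfl)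
    have e : (6 : ℕ) • (((0 : Fin 3), (0 : Fin 9)) - (0, 1)) + (1 : ℕ) • (((0 : Fin 3), (6 : Fin 9)) - (2, 0)) = (1, 0) := by decide
    have h' := AddSubgroup.add_mem _ (AddSubgroup.nsmul_mem _ h1 6) (AddSubgroup.nsmul_mem _ h2 1)
    rw [e] at h'
    exact h'
  · have h1 := AddSubgroup.subset_closure (k := ({((0 : Fin 3), (0 : Fin 9)) - (0, 1), ((0 : Fin 3), (6 : Fin 9)) - (2, 0)} : Set (BB.Mono 3 9))) (Set.mem_insert _ _)
    have h2 := AddSubgroup.subset_closure (k := ({((0 : Fin 3), (0 : Fin 9)) - (0, 1), ((0 : Fin 3), (6 : Fin 9)) - (2, 0)} : Set (BB.Mono 3 9))) (Set.mem_insert_of_mem _ rfl)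
    have e : (8 : ℕ) • (((0 : Fin 3), (0 : Fin 9)) - (0, 1)) + (0 : ℕ) • (((0 : Fin 3), (6 : Fin 9)) - (2, 0)) = (0, 1) := by decide
    have h' := AddSubgroup.add_mem _ (AddSubgroup.nsmul_mem _ h1 8) (AddSubgroup.nsmul_mem _ h2 0)
    rw [e] at h'
    exact h'

set_option maxRecDepth 100000 in
/-- Orders of the two layout generators: `9` and `3` (product `27 = ℓm`). -/
theorem qc_layout_orders : addOrderOf (((0 : Fin 3), (0 : Fin 9)) - (0, 1)) = 9 ∧ addOrderOf (((0 : Fin 3), (6 : Fin 9)) - (2, 0)) = 3 :=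
  ⟨(addOrderOf_eq_iff (by norm_num)).mpr (by decide), (addOrderOf_eq_iff (by norm_num)).mpr (by decide)⟩

/-- **`qc` has a toric layout with `(μ, λ) = (9, 3)`** (Bravyi et al. 2024 Lemma 4 / `BB.Code.hasToricLayoutWith_of_exponents`):
census layout column, KERNEL. -/
theorem qc_hasToricLayoutWith : HasToricLayoutWith 9 3 qc.css.tannerGraph := by
  have h := qc.hasToricLayoutWith_of_exponents (g := ((0 : Fin 3), (0 : Fin 9))) (g' := (0, 1))
    (h := ((0 : Fin 3), (6 : Fin 9))) (h' := (2, 0)) (by decide) (by decide) (by decide) (by decide)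
    qc_layout_closure_eq_top (by rw [qc_layout_orders.1, qc_layout_orders.2])
  rwa [qc_layout_orders.1, qc_layout_orders.2] at h

/-- `qc` has a toric layout. KERNEL. -/
theorem qc_hasToricLayout : HasToricLayout qc.css.tannerGraph :=
  ⟨9, 3, by norm_num, by norm_num, qc_hasToricLayoutWith⟩

set_option maxRecDepth 100000 in
/-- **`qc`**: Tanner graph = edge-disjoint union of two layers whose components are wheel graphs `prismGraph 18` (`A₃A₂ᵀ` of order
`9`) and `prismGraph 18` (`B₂B₁ᵀ` of order `9`) — BCGMRY24 Lemma 2 minus planarity (`BB.Code.exists_wheel_layers`). KERNEL. -/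
theorem qc_wheel_layers :
    ∃ ΓA ΓB : SimpleGraph ((BB.Mono 3 9 ⊕ BB.Mono 3 9) ⊕ (BB.Mono 3 9 ⊕ BB.Mono 3 9)),
    qc.css.tannerGraph = ΓA ⊔ ΓB ∧ Disjoint ΓA ΓB ∧
    (∀ K : ΓA.ConnectedComponent, Nonempty (K.toSimpleGraph ≃g prismGraph 18)) ∧
    (∀ K : ΓB.ConnectedComponent, Nonempty (K.toSimpleGraph ≃g prismGraph 18)) := by
  have hA : ∀ g : BB.Mono 3 9, qc.A g ≠ 0 ↔ g = ((0 : Fin 3), (0 : Fin 9)) ∨ g = ((0 : Fin 3), (1 : Fin 9)) ∨ g = ((1 : Fin 3), (0 : Fin 9)) := by decide +kernel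
  have hB : ∀ g : BB.Mono 3 9, qc.B g ≠ 0 ↔ g = ((0 : Fin 3), (5 : Fin 9)) ∨ g = ((0 : Fin 3), (6 : Fin 9)) ∨ g = ((2 : Fin 3), (0 : Fin 9)) := by decide +kernel
  have h := qc.exists_wheel_layers (g₁ := ((0 : Fin 3), (0 : Fin 9))) (g₂ := ((0 : Fin 3), (1 : Fin 9))) (g₃ := ((1 : Fin 3), (0 : Fin 9))) (h₁ := ((0 : Fin 3), (5 : Fin 9)))
    (h₂ := ((0 : Fin 3), (6 : Fin 9))) (h₃ := ((2 : Fin 3), (0 : Fin 9))) (by decide) (by decide) (by decide) (by decide) (by decide) (by decide) hA hB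
  have e1 : addOrderOf (((1 : Fin 3), (0 : Fin 9)) - (0, 1)) = 9 := (addOrderOf_eq_iff (by norm_num)).mpr (by decide)
  have e2 : addOrderOf (((0 : Fin 3), (6 : Fin 9)) - (0, 5)) = 9 := (addOrderOf_eq_iff (by norm_num)).mpr (by decide)
  rw [e1, e2] at h
  exact h

end Summit.Ventures.QEC.Census.A1s_n54_k4_67d5b507

namespace Summit.Ventures.QEC.Census.A1s_n56_k6_dc07204f

open Matrix Literature.InformationTheory.QuantumCodes BBRows

/-- Monomials of `A = y + y^5 + x^3` (construction `A_terms = [[0, 1], [0, 5], [3, 0]]`, from the census generator file `census/search-3/gens/a1/A1s_n56_k6_dc07204f.json` (matrix_sha256 `dc07204f80e2944f…`; `A = y+y^5+x^3`, `B = y^4+y^6+x^2`)). DATA. -/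
def la : List (BB.Mono 4 7) := [(Fin.ofNat 4 0, Fin.ofNat 7 1), (Fin.ofNat 4 0, Fin.ofNat 7 5), (Fin.ofNat 4 3, Fin.ofNat 7 0)]

/-- Monomials of `B = y^4 + y^6 + x^2` (construction `B_terms = [[0, 4], [0, 6], [2, 0]]`). DATA. -/
def lb : List (BB.Mono 4 7) := [(Fin.ofNat 4 0, Fin.ofNat 7 4), (Fin.ofNat 4 0, Fin.ofNat 7 6), (Fin.ofNat 4 2, Fin.ofNat 7 0)]

/-- The census row's code as a TYPED two-block code `QC(y + y^5 + x^3, y^4 + y^6 + x^2)` on `ℤ_4 × ℤ_7` (`BB.Code 4 7`). (definition) -/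
def qc : BB.Code 4 7 := ⟨polyL la, polyL lb⟩

set_option maxRecDepth 100000 in
/-- INDEX IDENTITY, `X` side, in the kernel: the certificate's `H^X` rows ARE the `X`-check words of `qc` (`decide +kernel`). -/
theorem HX_eq_rowsX : A1s_n56_k6_dc07204f.cert.HX = rowsX la lb := by
  decide +kernel

set_option maxRecDepth 100000 in
/-- INDEX IDENTITY, `Z` side. -/
theorem HZ_eq_rowsZ : A1s_n56_k6_dc07204f.cert.HZ = rowsZ la lb := by
  decide +kernel

set_option maxRecDepth 100000 in
/-- The certificate's flat `H^X` is `qc.HXFlat`. -/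
theorem rowMatrix_HX_eq : rowMatrix 56 A1s_n56_k6_dc07204f.cert.HX = qc.HXFlat := by
  have cast : ∀ {H H' : List ℕ} (e : H = H'),
      rowMatrix 56 H = (rowMatrix 56 H').submatrix (Fin.cast (congrArg List.length e)) id := by
    intro H H' e; subst e; rfl
  exact (cast HX_eq_rowsX).trans (rowMatrix_rowsX qc (LA := la) (LB := lb) rfl rfl)

set_option maxRecDepth 100000 in
/-- The certificate's flat `H^Z` is `qc.HZFlat`. -/
theorem rowMatrix_HZ_eq : rowMatrix 56 A1s_n56_k6_dc07204f.cert.HZ = qc.HZFlat := by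
  have cast : ∀ {H H' : List ℕ} (e : H = H'),
      rowMatrix 56 H = (rowMatrix 56 H').submatrix (Fin.cast (congrArg List.length e)) id := by
    intro H H' e; subst e; rfl
  exact (cast HZ_eq_rowsZ).trans (rowMatrix_rowsZ qc (LA := la) (LB := lb) rfl rfl)

set_option maxRecDepth 100000 in
/-- `d^Z (qc) = 8`, transported from the census certificate (`A1s_n56_k6_dc07204f.dZ_eq`) by `BB.Code.dZ_eq_of_flat`. -/
theorem qc_dZ : qc.css.dZ = 8 :=
  (qc.dZ_eq_of_flat (D := A1s_n56_k6_dc07204f.cert.code A1s_n56_k6_dc07204f.commOK_cert)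
    rowMatrix_HX_eq rowMatrix_HZ_eq).symm.trans A1s_n56_k6_dc07204f.dZ_eq

set_option maxRecDepth 100000 in
/-- `k (qc) = 6`, transported from the census certificate (`A1s_n56_k6_dc07204f.k_eq`) by `BB.Code.k_eq_of_flat`. -/
theorem qc_k : qc.k = 6 :=
  (qc.k_eq_of_flat (D := A1s_n56_k6_dc07204f.cert.code A1s_n56_k6_dc07204f.commOK_cert)
    rowMatrix_HX_eq rowMatrix_HZ_eq).symm.trans A1s_n56_k6_dc07204f.k_eq

/-- **`QC(y + y^5 + x^3, y^4 + y^6 + x^2)` on `ℤ_4 × ℤ_7` has parameters `[[56, 6, 8]]`** (distance exact; `BB.HasParams`) — the census row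
`A1s_n56_k6_dc07204f` read as a statement about the construction. KERNEL. -/
theorem qc_hasParams : Summit.Ventures.QEC.BB.HasParams qc 56 6 8 :=
  BB.hasParams_of_dZ (by simp only [BB.numQubits_eq]) qc_k qc_dZ

/-- The same in the generic census vocabulary: `qc.css.IsCode 56 6 8`. -/
theorem qc_isCode : qc.css.IsCode 56 6 8 :=
  (BB.hasParams_iff_isCode (by decide)).1 qc_hasParams

set_option maxRecDepth 100000 in
/-- **The Tanner graph of `qc` is connected** (Bravyi et al. 2024 Lemma 3 / `BB.Code.tannerGraph_connected_of_unit_mem`): `x = (1,0)`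
and `y = (0,1)` are explicit combinations of exponent differences inside `A` or inside `B` (found by qec-type-05's tools/conn_cert.py,
re-checked by `decide`). Census column «connected» for this row, KERNEL. -/
theorem qc_tannerGraph_connected : qc.css.tannerGraph.Connected := by
  refine qc.tannerGraph_connected_of_unit_mem (fun h => absurd (congrFun h ((0 : Fin 4), (1 : Fin 7))) (by decide))
    (fun h => absurd (congrFun h ((0 : Fin 4), (4 : Fin 7))) (by decide)) ?_ ?_
  · have e : (((1 : Fin 4), (0 : Fin 7)) : BB.Mono 4 7) = (21 : ℕ) • ((((0 : Fin 4), (1 : Fin 7))) - (3, 0)) := by decide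
    rw [e]
    exact (AddSubgroup.nsmul_mem _ (qc.sub_mem_expDiffSubgroup_A (by decide) (by decide)) 21)
  · have e : (((0 : Fin 4), (1 : Fin 7)) : BB.Mono 4 7) = (5 : ℕ) • ((((0 : Fin 4), (1 : Fin 7))) - (0, 5)) := by decide
    rw [e]
    exact (AddSubgroup.nsmul_mem _ (qc.sub_mem_expDiffSubgroup_A (by decide) (by decide)) 5)

set_option maxRecDepth 100000 in
/-- **`qc`**: Tanner graph = edge-disjoint union of two layers whose components are wheel graphs `prismGraph 56` (`A₃A₂ᵀ` of order
`28`) and `prismGraph 14` (`B₂B₁ᵀ` of order `7`) — BCGMRY24 Lemma 2 minus planarity (`BB.Code.exists_wheel_layers`). KERNEL. -/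
theorem qc_wheel_layers :
    ∃ ΓA ΓB : SimpleGraph ((BB.Mono 4 7 ⊕ BB.Mono 4 7) ⊕ (BB.Mono 4 7 ⊕ BB.Mono 4 7)),
    qc.css.tannerGraph = ΓA ⊔ ΓB ∧ Disjoint ΓA ΓB ∧
    (∀ K : ΓA.ConnectedComponent, Nonempty (K.toSimpleGraph ≃g prismGraph 56)) ∧
    (∀ K : ΓB.ConnectedComponent, Nonempty (K.toSimpleGraph ≃g prismGraph 14)) := by
  have hA : ∀ g : BB.Mono 4 7, qc.A g ≠ 0 ↔ g = ((0 : Fin 4), (1 : Fin 7)) ∨ g = ((0 : Fin 4), (5 : Fin 7)) ∨ g = ((3 : Fin 4), (0 : Fin 7)) := by decide +kernel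
  have hB : ∀ g : BB.Mono 4 7, qc.B g ≠ 0 ↔ g = ((0 : Fin 4), (4 : Fin 7)) ∨ g = ((0 : Fin 4), (6 : Fin 7)) ∨ g = ((2 : Fin 4), (0 : Fin 7)) := by decide +kernel
  have h := qc.exists_wheel_layers (g₁ := ((0 : Fin 4), (1 : Fin 7))) (g₂ := ((0 : Fin 4), (5 : Fin 7))) (g₃ := ((3 : Fin 4), (0 : Fin 7))) (h₁ := ((0 : Fin 4), (4 : Fin 7)))
    (h₂ := ((0 : Fin 4), (6 : Fin 7))) (h₃ := ((2 : Fin 4), (0 : Fin 7))) (by decide) (by decide) (by decide) (by decide) (by decide) (by decide) hA hB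
  have e1 : addOrderOf (((3 : Fin 4), (0 : Fin 7)) - (0, 5)) = 28 := (addOrderOf_eq_iff (by norm_num)).mpr (by decide)
  have e2 : addOrderOf (((0 : Fin 4), (6 : Fin 7)) - (0, 4)) = 7 := (addOrderOf_eq_iff (by norm_num)).mpr (by decide)
  rw [e1, e2] at h
  exact h

end Summit.Ventures.QEC.Census.A1s_n56_k6_dc07204f
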